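import Literature.MathematicalPhysics.QuantumFieldTheory.OSGlaserHolomorphy
import Literature.MathematicalPhysics.QuantumFieldTheory.OSDistributionSpaceTimeGroup
import Literature.MathematicalPhysics.QuantumFieldTheory.OSDistributionSpaceGapContinuation
import Literature.MathematicalPhysics.QuantumFieldTheory.OSLaplaceSchwinger
import HarnessLib

/-!
# Glaser vectors in the OS Hilbert space, III: the kernel identities and the time translations

Third support file (everything proved, no named facts) of the route to
`Literature.MathematicalPhysics.QuantumFieldTheory.OS1973_cluster` through Glaser vectors
(`OSGlaserVectors`, `OSGlaserHolomorphy`). For an E1–E2 Schwinger family with holomorphic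
continuations `𝔚ₙ` (`GlaserHyp`), a ray smearing `ρ = ∫ G(x) Ψ(x + isη) dx` of a compactly
supported Minkowski test function `G` and an arbitrary smearing `τ`:

* `GlaserHyp.inner_glaserVec_ofRay` — **the Gram identity** `⟪b_τ, b_ρ⟫ = 𝕂(τ, ρ)` (analytic
  continuation in the deformation parameter `μ` of `OSGlaserHolomorphy.rayFam` from the Euclidean
  end `μ = iν`, where `b` is a basis vector `δ_g` and the identity is the definition of the Glaser
  vectors, to `μ = 1`; identity theorem on the strip);
* `GlaserHyp.inner_holoShiftH_glaserVec_ofRay` — **the holomorphic semigroup acts by complex time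
  shifts**: `⟪b_τ, e^{-τ'H} b_ρ⟫ = 𝕂(τ, ρ + iτ' ê₀)` for `Re τ' ≥ 0` (for real `τ' = r > 0` the
  semigroup is the Euclidean time shift of OS I §4.1, which moves the Euclidean end `δ_g` to
  `δ_{g(· - r e₀)}`; continuation in `μ`, then in `τ'` by `eq_of_eqOn_ofReal`); in particular the
  unitary time translations `U(t) = e^{itH}` shift the real Minkowski times of the ray points
  (`GlaserHyp.inner_timeGroupOp_glaserVec_ofRay`);
* `smKernel_ofRay_rayShiftFam_eval_ofReal` — the resulting pairing in terms of the continued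
  Schwinger function on the appended ray: for two ray smearings,
  `⟪b_{F}, U(t) b_{G}⟫ = ∫ 𝔚_{n+m}(X + i s η^{nm}) (F^† ⊗ G(· − t ê₀))(X) dX`, the quantity whose
  `s → 0⁺` limit is the boundary value `𝒲_{n+m}(F^† ⊗ G_t)` (sequel `OSSpectralSupport`).

## References

* V. Glaser, Comm. Math. Phys. 37 (1974) 257–272, §2. [GlaserCMP1974]
* K. Osterwalder, R. Schrader, Comm. Math. Phys. 31 (1973) 83–112, §4.1 (4.5)–(4.10), §4.3.
  [OsterwalderSchraderCMP1973]
-/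

noncomputable section

open MeasureTheory Filter Complex ComplexConjugate Metric Set
open scoped Topology ComplexOrder SchwartzMap BigOperators InnerProductSpace

namespace Literature.MathematicalPhysics.QuantumFieldTheory

open Literature.MathematicalPhysics.QuantumLattice Literature.Analysis.Complex
open Literature.MathematicalPhysics.QuantumLattice.SchwingerFamily (OSSpace OSHilbert PosGen genPairing shiftGen
  timeVec shiftGen_of_nonneg)
open Literature.MathematicalPhysics.QuantumLattice.SchwingerFamily.OSSpace

variable {d : ℕ}

/-! ### The identity theorem from the imaginary segment -/

section Identity

/-- **Identity theorem on a preconnected open set from the segment `i (0, ν₀)`**: two holomorphic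
functions on `V` agreeing at `iν`, `0 < ν < ν₀` (points of `V`), agree on `V`. [folklore] -/
theorem eqOn_of_eqOn_I_mul {V : Set ℂ} (hV : IsOpen V) (hVc : IsPreconnected V) {f g : ℂ → ℂ}
    (hf : DifferentiableOn ℂ f V) (hg : DifferentiableOn ℂ g V) {ν₀ : ℝ} (hν₀ : 0 < ν₀)
    (hmem : ∀ ν ∈ Ioo 0 ν₀, I * ν ∈ V) (heq : ∀ ν ∈ Ioo 0 ν₀, f (I * ν) = g (I * ν)) : EqOn f g V := by
  have hz₀ : I * ((ν₀ / 2 : ℝ) : ℂ) ∈ V := hmem _ ⟨by positivity, by linarith⟩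
  refine (hf.analyticOnNhd hV).eqOn_of_preconnected_of_frequently_eq (hg.analyticOnNhd hV) hVc hz₀ ?_
  -- the imaginary segment accumulates at `i ν₀/2`
  have hT : Tendsto (fun ν : ℝ => I * ν) (𝓝[≠] (ν₀ / 2)) (𝓝[≠] (I * ((ν₀ / 2 : ℝ) : ℂ))) := by
    refine tendsto_nhdsWithin_of_tendsto_nhds_of_eventually_within _
      ((continuous_const.mul Complex.continuous_ofReal).continuousAt.tendsto.mono_left nhdsWithin_le_nhds) ?_
    filter_upwards [self_mem_nhdsWithin] with ν hν
    simp only [mem_compl_iff, mem_singleton_iff, mul_eq_mul_left_iff, I_ne_zero, or_false,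
      Complex.ofReal_inj]
    exact hν
  refine hT.frequently (Eventually.frequently ?_)
  have hIoo : Ioo 0 ν₀ ∈ 𝓝[≠] (ν₀ / 2) :=
    mem_nhdsWithin_of_mem_nhds (Ioo_mem_nhds (by positivity) (by linarith))
  filter_upwards [hIoo] with ν hν using heq ν hν

end Identity

/-! ### Translated nice generators -/

section Translate

variable {m n : ℕ}

/-- Time translation by `r ≥ 0` preserves time-ordering. [folklore] -/
theorem IsTimeOrdered.translateMulti_timeVec {F : 𝓢((Fin m → SpaceTime d), ℂ)} (hF : IsTimeOrdered F)
    {r : ℝ} (hr : 0 ≤ r) : IsTimeOrdered (translateMulti (timeVec r : SpaceTime d) F) := by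
  intro x hx
  have hx' := Literature.MathematicalPhysics.QuantumFieldTheory.tsupport_translateMulti_subset _ F hx
  have hmem := hF hx'
  have h0 : ∀ k, (x k - (timeVec r : SpaceTime d)) 0 = x k 0 - r := fun k => by simp [timeVec]
  refine ⟨fun k => ?_, fun i j hij => ?_⟩
  · have := hmem.1 k; rw [h0] at this; linarith
  · have := hmem.2 hij; simp only [h0] at this; linarith

/-- Time translation by `r ≥ 0` preserves nice generators. [folklore] -/
theorem isNiceGen_shiftGen {r : ℝ} (hr : 0 ≤ r) {q : PosGen (d + 1)} (hq : IsNiceGen q) :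
    IsNiceGen (shiftGen r q) := by
  rw [shiftGen_of_nonneg hr]
  exact ⟨IsTimeOrdered.translateMulti_timeVec hq.1 hr, hasCompactSupport_translateMulti hq.2⟩

/-- `timeVec t = t • ê₀`. [folklore] -/
theorem timeVec_eq_smul_e₀ (t : ℝ) : (timeVec t : SpaceTime d) = t • e₀ d := by
  ext i; by_cases hi : i = 0
  · subst hi; simp [timeVec, e₀_apply]
  · simp [timeVec, e₀_apply, hi]

/-- Translating the pushed-forward test function in time moves the shift vector. [folklore] -/
theorem translateMulti_pushTest (ν : ℝ) (hν : ν ≠ 0) (s r t : ℝ) (G : 𝓢((Fin m → SpaceTime d), ℂ)) :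
    translateMulti (timeVec t : SpaceTime d) (pushTest ν hν (rayShiftVec d m s r) G) =
      pushTest ν hν (rayShiftVec d m s (r + t)) G := by
  ext y
  rw [translateMulti_apply, pushTest_apply, pushTest_apply]
  congr 3
  funext k
  simp only [Pi.sub_apply, rayShiftVec, timeVec_eq_smul_e₀]
  module

end Translate

/-! ### The Gram identity for ray smearings -/

section Gram

variable {m n : ℕ} [NeZero d] {S : SchwingerFamily (EuclideanSpace ℝ (Fin (d + 1)))}
  {𝔚 : (n : ℕ) → (Fin n → Fin (d + 1) → ℂ) → ℂ}

/-- `⟪b_σ, δ_{(n, F)}⟫ = 𝕂(σ, Euclidean smearing of F)` for time-ordered compactly supported `F`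
(restatement of `inner_glaserVec_ι_δ` with the Euclidean smearing explicit). [folklore] -/
theorem GlaserHyp.inner_glaserVec_ι_δ_ofEuclid (h : GlaserHyp S 𝔚) (hE2 : S.IsOSReflectionPositive)
    (σ : Σ k, Smearing d k) (F : 𝓢((Fin n → SpaceTime d), ℂ)) (hF : IsTimeOrdered F)
    (hFc : HasCompactSupport (F : (Fin n → SpaceTime d) → ℂ)) (hP : IsPositiveTimeMulti F) :
    ⟪h.glaserVec hE2 σ, ι S hE2 (δ S hE2 ⟨n, ⟨F, hP⟩⟩)⟫_ℂ = smKernel 𝔚 σ ⟨n, Smearing.ofEuclid F hF hFc⟩ :=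
  h.inner_glaserVec_ι_δ hE2 σ ⟨n, ⟨F, hP⟩⟩ ⟨hF, hFc⟩

/-- **The Gram identity for a ray smearing**: `⟪b_τ, b_ρ⟫ = 𝕂(τ, ρ)` for every smearing `τ` and
the ray smearing `ρ` of a compactly supported test function (Glaser (1974), §2; OS I (1973), §4.3
(4.24): the scalar products of the vectors of Minkowski test functions are the continued Schwinger
functions). Proof: along the deformation `rayFam` both sides are holomorphic in `μ` on the strip,
and they agree at `μ = iν` (small `ν > 0`), where `b_{σ_{iν}} = δ_g` and the identity is
`inner_glaserVec_ι_δ`. [cite: GlaserCMP1974, §2] -/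
theorem GlaserHyp.inner_glaserVec_ofRay (h : GlaserHyp S 𝔚) (hE2 : S.IsOSReflectionPositive)
    (τ : Smearing d n) {s : ℝ} (hs : 0 < s) (G : 𝓢((Fin m → SpaceTime d), ℂ))
    (hGc : HasCompactSupport (G : (Fin m → SpaceTime d) → ℂ)) :
    ⟪h.glaserVec hE2 ⟨n, τ⟩, h.glaserVec hE2 ⟨m, Smearing.ofRay hs G G.continuous hGc⟩⟫_ℂ =
      smKernel 𝔚 ⟨n, τ⟩ ⟨m, Smearing.ofRay hs G G.continuous hGc⟩ := by
  obtain ⟨R, hR, hGR⟩ := exists_abs_time_le_of_hasCompactSupport hGc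
  set f := rayFam s 0 R le_rfl hR G G.continuous hGc hGR with hf
  -- both sides along the family
  have h1 : DifferentiableOn ℂ (fun μ => ⟪h.glaserVec hE2 ⟨n, τ⟩, h.glaserVec hE2 ⟨m, f.eval μ⟩⟫_ℂ) f.V :=
    h.differentiableOn_inner_glaserVec_eval hE2 f (h.glaserVec_mem hE2 _)
  have h2 : DifferentiableOn ℂ (fun μ => smKernel 𝔚 ⟨n, τ⟩ ⟨m, f.eval μ⟩) f.V :=
    h.differentiableOn_smKernel_eval τ f
  have hV : f.V = rayFamV s R := rfl
  set ν₀ : ℝ := s / (2 * (R + 1)) with hν₀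
  have hν₀pos : 0 < ν₀ := by positivity
  have hsmall : ∀ ν ∈ Ioo 0 ν₀, 2 * (R + 1) * |ν| < s := by
    intro ν hν
    rw [abs_of_pos hν.1]
    have := hν.2; rw [hν₀, lt_div_iff₀ (by positivity)] at this; linarith
  have heq := eqOn_of_eqOn_I_mul f.isOpen_V (hV ▸ (convex_rayFamV s R hR).isPreconnected) h1 h2 hν₀pos
    (fun ν hν => I_mul_mem_rayFamV (hsmall ν hν)) (fun ν hν => by
      rw [h.glaserVec_rayFam_eval_I_mul hE2 le_rfl hR hν.1 (hsmall ν hν) G hGc hGR]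
      change ⟪h.glaserVec hE2 ⟨n, τ⟩, ι S hE2 (δ S hE2 ⟨m, ⟨pushTest ν hν.1.ne' (rayShiftVec d m s 0) G, _⟩⟩)⟫_ℂ = _
      rw [h.inner_glaserVec_ι_δ_ofEuclid hE2 _ _ (isTimeOrdered_pushTest hν.1 (hsmall ν hν) le_rfl hR G hGc hGR)
        (hasCompactSupport_pushTest ν hν.1.ne' _ G hGc),
        smKernel_rayFam_eval_I_mul_right le_rfl hR hν.1 (hsmall ν hν) G hGc hGR τ]
      rfl)
  have hone : (1 : ℂ) ∈ f.V := by
    rw [hV]; simpa using ofReal_mem_rayFamV hs R 1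
  have key : ⟪h.glaserVec hE2 ⟨n, τ⟩, h.glaserVec hE2 ⟨m, (rayFam s 0 R le_rfl hR G G.continuous hGc hGR).eval 1⟩⟫_ℂ =
      smKernel 𝔚 ⟨n, τ⟩ ⟨m, (rayFam s 0 R le_rfl hR G G.continuous hGc hGR).eval 1⟩ := heq hone
  rwa [h.glaserVec_rayFam_eval_one hE2 hs hR G hGc hGR, smKernel_rayFam_eval_one_right hs hR G hGc hGR] at key

end Gram

/-! ### `ℋ₀` is invariant under the time-translation semigroup -/

section ShiftInvariance

variable [NeZero d] {S : SchwingerFamily (EuclideanSpace ℝ (Fin (d + 1)))} {hE2 : S.IsOSReflectionPositive}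

omit [NeZero d] in
/-- The time translation of a vector of the nice module lies in the nice module. [folklore] -/
theorem shiftOp_mem_niceModule {r : ℝ} (hr : 0 ≤ r) {w : OSSpace S hE2} (hw : w ∈ niceModule S hE2) :
    shiftOp S hE2 r w ∈ niceModule S hE2 := by
  classical
  rw [mem_niceModule_iff] at hw ⊢
  have hsymm : (OSSpace.of S hE2).symm (shiftOp S hE2 r w) =
      Finsupp.mapDomain (shiftGen r) ((OSSpace.of S hE2).symm w) := by
    conv_lhs => rw [← OSSpace.of_symm_eq w, OSSpace.shiftOp_of]
    exact (OSSpace.of S hE2).symm_apply_apply _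
  rw [hsymm]
  intro q hq
  obtain ⟨p, hp, rfl⟩ := Finset.mem_image.1 (Finsupp.mapDomain_support (Finset.mem_coe.1 hq))
  exact isNiceGen_shiftGen hr (hw (Finset.mem_coe.2 hp))

omit [NeZero d] in
/-- **`e^{-rH}` maps `ℋ₀` into itself** (`r ≥ 0`): it maps `δ_q` to `δ_{q(· - r e₀)}`, which is
again nice. [folklore] -/
theorem shiftH_mem_niceClosure (hE1 : S.IsEuclideanCovariant) {r : ℝ} (hr : 0 ≤ r) {x : OSHilbert S hE2}
    (hx : x ∈ niceClosure S hE2) : shiftH hE2 r x ∈ niceClosure S hE2 := by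
  set K : Submodule ℂ (OSHilbert S hE2) := (niceModule S hE2).map (ι S hE2).toLinearMap with hK
  have hx' : x ∈ closure (K : Set (OSHilbert S hE2)) := by
    rw [hK, ← Submodule.topologicalClosure_coe]; exact hx
  have himg : shiftH hE2 r '' (K : Set (OSHilbert S hE2)) ⊆ K := by
    rintro y ⟨v, ⟨w, hw, rfl⟩, rfl⟩
    refine ⟨shiftOp S hE2 r w, shiftOp_mem_niceModule hr hw, ?_⟩
    change ι S hE2 (shiftOp S hE2 r w) = shiftH hE2 r (ι S hE2 w)
    rw [OSSpace.shiftH_ι hE1]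
  have hmem : shiftH hE2 r x ∈ closure (K : Set (OSHilbert S hE2)) :=
    (closure_mono himg) (image_closure_subset_closure_image (shiftH hE2 r).continuous ⟨x, hx', rfl⟩)
  change shiftH hE2 r x ∈ (niceClosure S hE2 : Set (OSHilbert S hE2))
  rw [niceClosure, Submodule.topologicalClosure_coe]
  exact hmem

end ShiftInvariance

/-! ### The family of complex time shifts of a ray smearing -/

section ShiftFamily

variable {m n : ℕ}

/-- The ray points shifted by a common complex time `ζ` are mixed points when `s + Im ζ > 0`. [folklore] -/
theorem rayConfig_add_smul_timeDirC_eq_mixedPoint (s : ℝ) (ζ : ℂ) (u : Fin m → SpaceTime d) :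
    rayConfig (stdDir d m) u s + ζ • timeDirC d m =
      mixedPoint (fun k => u k + (s * (((k : ℕ) : ℝ) + 1) + ζ.im - u k 0) • e₀ d) fun k => u k 0 + ζ.re := by
  funext k i
  rw [Pi.add_apply, Pi.add_apply, Pi.smul_apply, Pi.smul_apply, rayConfig_apply, stdDir_apply]
  by_cases hi : i = 0
  · subst hi
    simp [mixedPoint, timeDirC, e₀_apply]
    conv_lhs => rw [← Complex.re_add_im ζ]
    ring
  · simp [mixedPoint, timeDirC, e₀_apply, hi]

/-- **The family of complex time shifts** `ζ ↦ (u + i s η) + ζ ê₀` of the ray smearing of `G`,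
holomorphic on `{Im ζ > −s}`. [folklore] -/
def rayShiftFam (s : ℝ) (hs : 0 < s) (G : (Fin m → SpaceTime d) → ℂ) (hG : Continuous G)
    (hGc : HasCompactSupport G) : SmearingFamily d m where
  φ := fun ζ u => rayConfig (stdDir d m) u s + ζ • timeDirC d m
  w := G
  U := univ
  V := {ζ | -s < ζ.im}
  isOpen_V := isOpen_lt continuous_const Complex.continuous_im
  isOpen_U := isOpen_univ
  nonempty_U := univ_nonempty
  continuousOn_φ := (((continuous_rayConfig_left _ _).comp continuous_snd).add
    (continuous_fst.smul continuous_const)).continuousOn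
  differentiableOn_φ := fun u _ =>
    ((differentiable_const (rayConfig (stdDir d m) u s)).add
      (differentiable_id.smul_const (timeDirC d m))).differentiableOn
  mem_mixedPts := fun ζ hζ u _ => by
    refine ⟨_, ⟨fun k => ?_, fun i j hij => ?_⟩, _, rayConfig_add_smul_timeDirC_eq_mixedPoint s ζ u⟩
    · simp [e₀_apply]
      have h0 : (0 : ℝ) ≤ (k : ℕ) := Nat.cast_nonneg _
      have : -s < ζ.im := hζ
      nlinarith
    · simp only [PiLp.add_apply, PiLp.smul_apply, e₀_apply, if_true, smul_eq_mul, mul_one]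
      have h3 : ((i : ℕ) : ℝ) + 1 ≤ (j : ℕ) := by
        have : (i : ℕ) < (j : ℕ) := hij
        exact_mod_cast this
      nlinarith
  continuous_w := hG
  hasCompactSupport_w := hGc
  tsupport_subset := subset_univ _

/-- `iτ'` lies in the shift domain for `Re τ' ≥ 0`. [folklore] -/
theorem I_mul_mem_rayShiftFam_V {s : ℝ} (hs : 0 < s) {G : (Fin m → SpaceTime d) → ℂ} {hG : Continuous G}
    {hGc : HasCompactSupport G} {τ' : ℂ} (hτ' : -s < τ'.re) :
    I * τ' ∈ (rayShiftFam s hs G hG hGc).V := by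
  change -s < (I * τ').im; simpa using hτ'

/-- Real shifts lie in the shift domain. [folklore] -/
theorem ofReal_mem_rayShiftFam_V {s : ℝ} (hs : 0 < s) {G : (Fin m → SpaceTime d) → ℂ} {hG : Continuous G}
    {hGc : HasCompactSupport G} (t : ℝ) : (t : ℂ) ∈ (rayShiftFam s hs G hG hGc).V := by
  change -s < (t : ℂ).im; simpa using hs

variable {𝔚 : (n : ℕ) → (Fin n → Fin (d + 1) → ℂ) → ℂ}

/-- **The deformation at `μ = 1` with imaginary shift `r` has the kernels of the shift family at
`ζ = ir`** (same points and weight). [folklore] -/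
theorem smKernel_rayFam_eval_one_eq_rayShiftFam {s r R : ℝ} (hs : 0 < s) (hr : 0 ≤ r) (hR : 0 ≤ R)
    (G : 𝓢((Fin m → SpaceTime d), ℂ)) (hGc : HasCompactSupport (G : (Fin m → SpaceTime d) → ℂ))
    (hGR : ∀ u ∈ tsupport (G : (Fin m → SpaceTime d) → ℂ), ∀ k, |u k 0| ≤ R) (τ : Smearing d n) :
    smKernel 𝔚 ⟨n, τ⟩ ⟨m, (rayFam s r R hr hR G G.continuous hGc hGR).eval 1⟩ =
      smKernel 𝔚 ⟨n, τ⟩ ⟨m, (rayShiftFam s hs G G.continuous hGc).eval (I * r)⟩ := by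
  have hμ : (1 : ℂ) ∈ (rayFam s r R hr hR G G.continuous hGc hGR).V := by
    change (1 : ℂ) ∈ rayFamV s R; simp [rayFamV, hs]
  have hζ : I * (r : ℂ) ∈ (rayShiftFam s hs G G.continuous hGc).V := by
    change -s < (I * (r : ℂ)).im; simp; linarith
  rw [smKernel_apply, smKernel_apply]
  simp only [SmearingFamily.eval_φ _ hμ, SmearingFamily.eval_w _ hμ, SmearingFamily.eval_φ _ hζ,
    SmearingFamily.eval_w _ hζ]
  change ∫ u, ∫ u', osKernel 𝔚 ⟨n, τ.φ u⟩ ⟨m, rayFamφ d m s r 1 u'⟩ * (conj (τ.w u) * G u') =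
    ∫ u, ∫ u', osKernel 𝔚 ⟨n, τ.φ u⟩ ⟨m, rayConfig (stdDir d m) u' s + (I * (r : ℂ)) • timeDirC d m⟩ *
      (conj (τ.w u) * G u')
  simp only [rayFamφ_one]

end ShiftFamily

/-! ### The holomorphic semigroup and the unitary group on Glaser vectors of rays -/

section Semigroup

variable {m n : ℕ} [NeZero d] {S : SchwingerFamily (EuclideanSpace ℝ (Fin (d + 1)))}
  {𝔚 : (n : ℕ) → (Fin n → Fin (d + 1) → ℂ) → ℂ}

/-- **`e^{-rH}` on the Glaser vector of a ray is the imaginary time shift `ir` of the ray**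
(`r > 0`; OS I (1973), §4.1: `e^{-tH} v(f) = v(f_t)` on the Euclidean end, continued in the
deformation parameter). [cite: OsterwalderSchraderCMP1973, §4.1 eqs. (4.5)–(4.10)] -/
theorem GlaserHyp.inner_shiftH_glaserVec_ofRay (h : GlaserHyp S 𝔚) (hE2 : S.IsOSReflectionPositive)
    (τ : Smearing d n) {s : ℝ} (hs : 0 < s) (G : 𝓢((Fin m → SpaceTime d), ℂ))
    (hGc : HasCompactSupport (G : (Fin m → SpaceTime d) → ℂ)) {r : ℝ} (hr : 0 < r) :
    ⟪h.glaserVec hE2 ⟨n, τ⟩, shiftH hE2 r (h.glaserVec hE2 ⟨m, Smearing.ofRay hs G G.continuous hGc⟩)⟫_ℂ =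
      smKernel 𝔚 ⟨n, τ⟩ ⟨m, (rayShiftFam s hs G G.continuous hGc).eval (I * r)⟩ := by
  obtain ⟨R, hR, hGR⟩ := exists_abs_time_le_of_hasCompactSupport hGc
  set f₀ := rayFam s 0 R le_rfl hR G G.continuous hGc hGR with hf₀
  set fr := rayFam s r R hr.le hR G G.continuous hGc hGR with hfr
  have hV₀ : f₀.V = rayFamV s R := rfl
  have hVr : fr.V = rayFamV s R := rfl
  -- the two holomorphic functions of `μ`
  have ha : shiftH hE2 r (h.glaserVec hE2 ⟨n, τ⟩) ∈ niceClosure S hE2 :=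
    shiftH_mem_niceClosure h.covariant hr.le (h.glaserVec_mem hE2 _)
  have h1 : DifferentiableOn ℂ (fun μ => ⟪h.glaserVec hE2 ⟨n, τ⟩, shiftH hE2 r (h.glaserVec hE2 ⟨m, f₀.eval μ⟩)⟫_ℂ)
      (rayFamV s R) := by
    have := h.differentiableOn_inner_glaserVec_eval hE2 f₀ ha
    refine (hV₀ ▸ this).congr fun μ _ => ?_
    exact (OSSpace.inner_shiftH_left h.covariant hr.le _ _).symm
  have h2 : DifferentiableOn ℂ (fun μ => smKernel 𝔚 ⟨n, τ⟩ ⟨m, fr.eval μ⟩) (rayFamV s R) :=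
    hVr ▸ h.differentiableOn_smKernel_eval τ fr
  set ν₀ : ℝ := s / (2 * (R + 1)) with hν₀
  have hν₀pos : 0 < ν₀ := by positivity
  have hsmall : ∀ ν ∈ Ioo 0 ν₀, 2 * (R + 1) * |ν| < s := by
    intro ν hν
    rw [abs_of_pos hν.1]
    have := hν.2; rw [hν₀, lt_div_iff₀ (by positivity)] at this; linarith
  have heq := eqOn_of_eqOn_I_mul (isOpen_rayFamV s R) ((convex_rayFamV s R hR).isPreconnected) h1 h2 hν₀pos
    (fun ν hν => I_mul_mem_rayFamV (hsmall ν hν)) (fun ν hν => by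
      -- the Euclidean end: `b = δ_g`, `e^{-rH} δ_g = δ_{g(· - r e₀)}`
      rw [h.glaserVec_rayFam_eval_I_mul hE2 le_rfl hR hν.1 (hsmall ν hν) G hGc hGR,
        ← OSSpace.holoShiftH_ofReal h.covariant hr, OSSpace.holoShiftH_ofReal h.covariant hr,
        OSSpace.shiftH_ι h.covariant, OSSpace.shiftOp_δ, shiftGen_of_nonneg hr.le]
      have hgen : (⟨m, ⟨translateMulti (timeVec r : SpaceTime d) (pushTest ν hν.1.ne' (rayShiftVec d m s 0) G),
          SchwingerFamily.IsPositiveTimeMulti.translateMulti_timeVec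
            (isTimeOrdered_pushTest hν.1 (hsmall ν hν) le_rfl hR G hGc hGR).isPositiveTimeMulti hr.le⟩⟩ :
            PosGen (d + 1)) =
          ⟨m, ⟨pushTest ν hν.1.ne' (rayShiftVec d m s r) G,
            (isTimeOrdered_pushTest hν.1 (hsmall ν hν) hr.le hR G hGc hGR).isPositiveTimeMulti⟩⟩ := by
        congr 2
        rw [translateMulti_pushTest, zero_add]
      change ⟪h.glaserVec hE2 ⟨n, τ⟩, ι S hE2 (δ S hE2 ⟨m, ⟨translateMulti (timeVec r : SpaceTime d)
        (pushTest ν hν.1.ne' (rayShiftVec d m s 0) G), _⟩⟩)⟫_ℂ = _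
      rw [hgen, h.inner_glaserVec_ι_δ_ofEuclid hE2 _ _ (isTimeOrdered_pushTest hν.1 (hsmall ν hν) hr.le hR G hGc hGR)
        (hasCompactSupport_pushTest ν hν.1.ne' _ G hGc),
        smKernel_rayFam_eval_I_mul_right hr.le hR hν.1 (hsmall ν hν) G hGc hGR τ]
      rfl)
  have hone : (1 : ℂ) ∈ rayFamV s R := by simpa using ofReal_mem_rayFamV hs R 1
  have key : ⟪h.glaserVec hE2 ⟨n, τ⟩, shiftH hE2 r (h.glaserVec hE2
      ⟨m, (rayFam s 0 R le_rfl hR G G.continuous hGc hGR).eval 1⟩)⟫_ℂ =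
      smKernel 𝔚 ⟨n, τ⟩ ⟨m, (rayFam s r R hr.le hR G G.continuous hGc hGR).eval 1⟩ := heq hone
  rwa [h.glaserVec_rayFam_eval_one hE2 hs hR G hGc hGR,
    smKernel_rayFam_eval_one_eq_rayShiftFam hs hr.le hR G hGc hGR] at key

/-- **The holomorphic semigroup on the Glaser vector of a ray is the complex time shift**:
`⟪b_τ, e^{-τ'H} b_ρ⟫ = 𝕂(τ, ρ + iτ' ê₀)` for `Re τ' ≥ 0` (both sides are holomorphic on the open
right half-plane, continuous on the closed one, and agree on `(0, ∞)`). [cite: OsterwalderSchraderCMP1973, §4.1 eqs. (4.5)–(4.10)] -/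
theorem GlaserHyp.inner_holoShiftH_glaserVec_ofRay (h : GlaserHyp S 𝔚) (hE2 : S.IsOSReflectionPositive)
    (τ : Smearing d n) {s : ℝ} (hs : 0 < s) (G : 𝓢((Fin m → SpaceTime d), ℂ))
    (hGc : HasCompactSupport (G : (Fin m → SpaceTime d) → ℂ)) {τ' : ℂ} (hτ' : 0 ≤ τ'.re) :
    ⟪h.glaserVec hE2 ⟨n, τ⟩, holoShiftH (hE2 := hE2) h.covariant τ'
        (h.glaserVec hE2 ⟨m, Smearing.ofRay hs G G.continuous hGc⟩)⟫_ℂ =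
      smKernel 𝔚 ⟨n, τ⟩ ⟨m, (rayShiftFam s hs G G.continuous hGc).eval (I * τ')⟩ := by
  set sf := rayShiftFam s hs G G.continuous hGc with hsf
  have hmaps : ∀ z : ℂ, -s < z.re → I * z ∈ sf.V := fun z hz => I_mul_mem_rayShiftFam_V hs hz
  have hdiff : DifferentiableOn ℂ (fun z => smKernel 𝔚 ⟨n, τ⟩ ⟨m, sf.eval (I * z)⟩) {z : ℂ | -s < z.re} :=
    (h.differentiableOn_smKernel_eval τ sf).comp ((differentiable_const I).mul differentiable_id).differentiableOn
      fun z hz => hmaps z hz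
  refine eq_of_eqOn_ofReal (f := fun τ' => ⟪h.glaserVec hE2 ⟨n, τ⟩, holoShiftH (hE2 := hE2) h.covariant τ'
      (h.glaserVec hE2 ⟨m, Smearing.ofRay hs G G.continuous hGc⟩)⟫_ℂ)
    (g := fun z => smKernel 𝔚 ⟨n, τ⟩ ⟨m, sf.eval (I * z)⟩)
    (OSSpace.differentiableOn_inner_holoShiftH h.covariant _ _)
    (hdiff.mono fun z hz => by simp only [mem_setOf_eq] at hz ⊢; linarith)
    (OSSpace.continuousOn_inner_holoShiftH h.covariant _ _)
    (hdiff.continuousOn.mono fun z hz => by simp only [mem_setOf_eq] at hz ⊢; linarith)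
    (fun r hr => ?_) hτ'
  rw [OSSpace.holoShiftH_ofReal h.covariant hr]
  exact h.inner_shiftH_glaserVec_ofRay hE2 τ hs G hGc hr

/-- **The unitary time translations on the Glaser vector of a ray shift the real Minkowski times**:
`⟪b_τ, U(t) b_ρ⟫ = 𝕂(τ, ρ + t ê₀)`, `U(t) = e^{itH} = e^{-(-it)H}`. [cite: OsterwalderSchraderCMP1973, §4.4 eq. (4.30)] -/
theorem GlaserHyp.inner_timeGroupOp_glaserVec_ofRay (h : GlaserHyp S 𝔚) (hE2 : S.IsOSReflectionPositive)
    (τ : Smearing d n) {s : ℝ} (hs : 0 < s) (G : 𝓢((Fin m → SpaceTime d), ℂ))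
    (hGc : HasCompactSupport (G : (Fin m → SpaceTime d) → ℂ)) (t : ℝ) :
    ⟪h.glaserVec hE2 ⟨n, τ⟩, timeGroupOp (hE2 := hE2) h.covariant t
        (h.glaserVec hE2 ⟨m, Smearing.ofRay hs G G.continuous hGc⟩)⟫_ℂ =
      smKernel 𝔚 ⟨n, τ⟩ ⟨m, (rayShiftFam s hs G G.continuous hGc).eval t⟩ := by
  have := h.inner_holoShiftH_glaserVec_ofRay hE2 τ hs G hGc (τ' := -(I * t)) (by simp)
  have ht : I * -(I * (t : ℂ)) = t := by ring_nf; rw [I_sq]; ring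
  rw [ht] at this
  exact this

end Semigroup

/-! ### The pairing of two ray smearings through the continued Schwinger function -/

section Pairing

variable {m n : ℕ} {𝔚 : (n : ℕ) → (Fin n → Fin (d + 1) → ℂ) → ℂ}

/-- A common real time shift of the ray points is the ray of the shifted configuration. [folklore] -/
theorem rayConfig_add_ofReal_smul_timeDirC (η : Fin m → SpaceTime d) (u : Fin m → SpaceTime d) (s t : ℝ) :
    rayConfig η u s + ((t : ℝ) : ℂ) • timeDirC d m = rayConfig η (fun k => u k + t • e₀ d) s := by
  funext k i
  rw [Pi.add_apply, Pi.add_apply, Pi.smul_apply, Pi.smul_apply, rayConfig_apply, rayConfig_apply]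
  by_cases hi : i = 0
  · subst hi; simp [timeDirC, e₀_apply]; ring
  · simp [timeDirC, e₀_apply, hi]

/-- **The pairing of two ray smearings, the second shifted by the real time `t`, through the
continued Schwinger function on the appended ray**:
`𝕂(ρ_F, ρ_G + t ê₀) = ∫ 𝔚_{n+m}(X + i s η^{nm}) (F^† ⊗ G(· − t ê₀))(X) dX`
(`osKernel_rayConfig`; translation invariance of Lebesgue measure in the second block, the
reversal `x ↦ x ∘ rev` in the first). [cite: OsterwalderSchraderCMP1973, §4.3 eqs. (4.22)–(4.24)] -/
theorem smKernel_ofRay_rayShiftFam_eval_ofReal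
    (h𝔚 : ContinuousOn (𝔚 (n + m)) (forwardTube d (n + m)))
    (hinv : ∀ s' : ℝ, 0 ≤ s' → ∀ z ∈ forwardTube d (n + m), 𝔚 (n + m) (z + iTimeShift d (n + m) s') = 𝔚 (n + m) z)
    {s : ℝ} (hs : 0 < s) (F : 𝓢((Fin n → SpaceTime d), ℂ)) (hFc : HasCompactSupport (F : (Fin n → SpaceTime d) → ℂ))
    (G : 𝓢((Fin m → SpaceTime d), ℂ)) (hGc : HasCompactSupport (G : (Fin m → SpaceTime d) → ℂ)) (t : ℝ) :
    smKernel 𝔚 ⟨n, Smearing.ofRay hs F F.continuous hFc⟩ ⟨m, (rayShiftFam s hs G G.continuous hGc).eval t⟩ =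
      ∫ X, 𝔚 (n + m) (rayConfig (pairDir d n m) X s) *
        SchwartzMap.appendTensor (starTest (permTest Fin.revPerm F)) (translateMulti (t • e₀ d) G) X := by
  have hζ : (t : ℂ) ∈ (rayShiftFam s hs G G.continuous hGc).V := ofReal_mem_rayShiftFam_V hs t
  rw [smKernel_apply]
  simp only [SmearingFamily.eval_φ _ hζ, SmearingFamily.eval_w _ hζ, Smearing.ofRay_φ, Smearing.ofRay_w]
  change ∫ x, ∫ x', osKernel 𝔚 ⟨n, rayConfig (stdDir d n) x s⟩
      ⟨m, rayConfig (stdDir d m) x' s + ((t : ℝ) : ℂ) • timeDirC d m⟩ * (conj (F x) * G x') = _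
  -- the test function on the appended configuration
  set Ψ := SchwartzMap.appendTensor (starTest (permTest Fin.revPerm F)) (translateMulti (t • e₀ d) G) with hΨ
  have hΨc : HasCompactSupport (Ψ : (Fin (n + m) → SpaceTime d) → ℂ) :=
    hasCompactSupport_appendTensor (hasCompactSupport_starTest_permTest_revPerm hFc)
      (hasCompactSupport_translateMulti hGc)
  have hint : Integrable fun X : Fin (n + m) → SpaceTime d => 𝔚 (n + m) (rayConfig (pairDir d n m) X s) * Ψ X :=
    ((continuous_comp_rayConfig h𝔚 pairDir_mem_tubeCone hs).mul Ψ.continuous).integrable_of_hasCompactSupport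
      hΨc.mul_left
  rw [integral_finAppend_eq_integral_integral n m hint]
  -- the first block: `x ↦ x ∘ rev`
  rw [← integral_comp_rev (E := SpaceTime d) (fun y => ∫ x', 𝔚 (n + m) (rayConfig (pairDir d n m) (Fin.append y x') s) *
      Ψ (Fin.append y x'))]
  congr 1; funext x
  -- the second block: translate by `t ê₀`
  simp only [rayConfig_add_ofReal_smul_timeDirC]
  rw [← integral_add_right_eq_self (μ := volume) (fun x' => 𝔚 (n + m)
      (rayConfig (pairDir d n m) (Fin.append (fun k => x k.rev) x') s) * Ψ (Fin.append (fun k => x k.rev) x'))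
      (fun _ : Fin m => t • e₀ d)]
  congr 1; funext x'
  rw [osKernel_rayConfig hinv x (fun k => x' k + t • e₀ d) hs]
  congr 1
  rw [hΨ, SchwartzMap.appendTensor_apply, append_comp_castAdd, append_comp_natAdd,
    starTest_permTest_revPerm_apply, translateMulti_apply]
  simp only [Fin.rev_rev, Pi.add_apply, add_sub_cancel_right]

variable [NeZero d] {S : SchwingerFamily (EuclideanSpace ℝ (Fin (d + 1)))}

/-- **The matrix elements of the unitary time translations between Glaser vectors of rays**:
`⟪b_{ρ_F}, U(t) b_{ρ_G}⟫ = ∫ 𝔚_{n+m}(X + i s η^{nm}) (F^† ⊗ G(· − t ê₀))(X) dX`, the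
regularised form of OS I (1973), (4.30) whose `s → 0⁺` limit is `𝒲_{n+m}(F^† ⊗ G_t)`. [cite: OsterwalderSchraderCMP1973, §4.4 eq. (4.30)] -/
theorem GlaserHyp.inner_timeGroupOp_glaserVec_ofRay_ofRay (h : GlaserHyp S 𝔚) (hE2 : S.IsOSReflectionPositive)
    {s : ℝ} (hs : 0 < s) (F : 𝓢((Fin n → SpaceTime d), ℂ)) (hFc : HasCompactSupport (F : (Fin n → SpaceTime d) → ℂ))
    (G : 𝓢((Fin m → SpaceTime d), ℂ)) (hGc : HasCompactSupport (G : (Fin m → SpaceTime d) → ℂ)) (t : ℝ) :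
    ⟪h.glaserVec hE2 ⟨n, Smearing.ofRay hs F F.continuous hFc⟩, timeGroupOp (hE2 := hE2) h.covariant t
        (h.glaserVec hE2 ⟨m, Smearing.ofRay hs G G.continuous hGc⟩)⟫_ℂ =
      ∫ X, 𝔚 (n + m) (rayConfig (pairDir d n m) X s) *
        SchwartzMap.appendTensor (starTest (permTest Fin.revPerm F)) (translateMulti (t • e₀ d) G) X := by
  rw [h.inner_timeGroupOp_glaserVec_ofRay hE2 _ hs G hGc t]
  exact smKernel_ofRay_rayShiftFam_eval_ofReal (h.differentiableOn (n + m)).continuousOn (h.timeShift (n + m))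
    hs F hFc G hGc t

/-- **The norm of the Glaser vector of a ray**: `‖b_{ρ_G}‖² = ∫ 𝔚_{2m}(X + i s η^{mm}) (G^† ⊗ G)(X) dX`
(the regularised OS I (4.28)). [cite: OsterwalderSchraderCMP1973, §4.3 eq. (4.28)] -/
theorem GlaserHyp.norm_glaserVec_ofRay_sq (h : GlaserHyp S 𝔚) (hE2 : S.IsOSReflectionPositive)
    {s : ℝ} (hs : 0 < s) (G : 𝓢((Fin m → SpaceTime d), ℂ)) (hGc : HasCompactSupport (G : (Fin m → SpaceTime d) → ℂ)) :
    ((‖h.glaserVec hE2 ⟨m, Smearing.ofRay hs G G.continuous hGc⟩‖ ^ 2 : ℝ) : ℂ) =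
      ∫ X, 𝔚 (m + m) (rayConfig (pairDir d m m) X s) *
        SchwartzMap.appendTensor (starTest (permTest Fin.revPerm G)) G X := by
  have := h.inner_timeGroupOp_glaserVec_ofRay_ofRay hE2 hs G hGc G hGc 0
  rw [OSSpace.timeGroupOp_zero] at this
  change ⟪h.glaserVec hE2 _, h.glaserVec hE2 _⟫_ℂ = _ at this
  rw [inner_self_eq_norm_sq_to_K, zero_smul] at this
  have h0 : translateMulti (0 : SpaceTime d) G = G := by
    ext x; rw [translateMulti_apply]; simp
  rw [h0] at this
  exact_mod_cast this

end Pairing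


end Literature.MathematicalPhysics.QuantumFieldTheory
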